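import Summits.BirchSwinnertonDyer.Rank1Residual.GaloisImage.HauptmodulNineTowerSeven
import Summits.BirchSwinnertonDyer.Rank1Residual.GaloisImage.HauptmodulNineValuationVOne
import Summits.BirchSwinnertonDyer.Rank1Residual.GaloisImage.HauptmodulNineValuationVTwo
import HarnessLib

/-!
# The `3`-adic tower on the EXOTIC core at `v₃(j) ≥ 8`, `v₃(j) ≢ 0 (mod 3)`,
# `j/3^{v₃(j)} ∈ {2, 4, 5, 7} (mod 9)`: `ρ̄_{E,3}` onto implies `ρ̄_{E,3ⁿ}` onto for every `n`
# — via the level-`9` Hauptmodul and the unit normalisation (cell `b2b-bsdres`, team n1011,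
# seat p02 gen 6 — row T-b11-F4 'scalar-stabiliser tower criterion at 9', file F4c-H20: the
# assembly at `v₃(j) = 3k + 4 ≥ 10` and `v₃(j) = 3k + 5 ≥ 8`)

HONEST FRAMING (cell `b2b-bsdres`, run/shared/lean/b2b/bsd-rank1-residual/, verbatim in every
file): the goal of the cell is to DELETE the COMBINATION-SHAPED residual classes of the
Birch–Swinnerton-Dyer formula for ALL analytic-rank `≤ 1` elliptic curves over `ℚ` — "full BSD
formula for every rank `≤ 1` curve in class `C`" assembled STRICTLY from published theorems — so
that the rank-`≤ 1` remainder becomes exactly the CONSTRUCTION-SHAPED classes, which are TYPED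
(missing-input `Prop`s), NOT attempted. This is not "finishing BSD". Team n1011 (N10 / N11):
research route; no claim beyond the stated classes; labels UNCHANGED; nothing is booked. Theorems
only (no definition, no named fact).

## What this file proves

With `ε, e₁ = ±1` and `K = j(E)/3^{v₃(j)} ≡ ε − 3e₁ (mod 9)` (`K mod 9 = 7, 4, 5, 2` for
`(ε, e₁) = (1,1), (1,−1), (−1,1), (−1,−1)`):

* **`towerSurj_three_of_surj_of_nine_dvd_num_vone`** — `E/ℚ`, `ρ̄_{E,3}` onto, `k ≥ 2`,
  `9 ∣ num(j/3^{3k+4} − (ε − 3e₁))`: `ρ̄_{E,3ⁿ}` is onto for every `n`.  Invariant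
  `z = (3^{2k+2}θ/(2(θ³ − 24)(e₁(θ³ − 24) + 3^{k+1})))² − 1` of valuation `4/9`
  (`HauptmodulNineValuationVOne`), scalar-stabiliser criterion with `(d, a, b) = (9, 0, 4)`.
* **`towerSurj_three_of_surj_of_nine_dvd_num_vtwo`** — `k ≥ 1`, `9 ∣ num(j/3^{3k+5} − (ε − 3e₁))`:
  `ρ̄_{E,3ⁿ}` onto for every `n`.  Invariant
  `z = (θ(θ³ − 24)²/(2·3^{k+2}(θ³ − 24 − 3^{k+2}e₁)))² − 1` (`HauptmodulNineValuationVTwo`).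
* `imageContainsSL2_three_of_surj_of_nine_dvd_num_vone` / `…_vtwo` — Kato's (12.5.2) at `p = 3`.

With `HauptmodulNineTowerSeven` (41 cells) this discharges by KERNEL PROOFS the whole class
`v₃(j) ≥ 7`, `v₃(j) ≢ 0 (mod 3)`, `e = 9 present` of the EXOTIC core of the cell's `3`-adic census
(128 of the 749 `m = 3` cells: 41 + 32 + 55; EVIDENCE kit j135897, 128/128), and with the gen-5
families (`HauptmodulNineTower`, `…Five`, `…Three`, `…VZero`: 498 cells) the Hauptmodul route
covers 626 of the 749 cells.  NOT claimed (123 cells): `v₃(j) = 3 ∧ j/27 ≡ 8`, `v₃(j) ≡ 0 (mod 3)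
∧ v₃(j) ≥ 6 ∧ K ≡ ±1`, `v₃(j) = 7 ∧ K ≡ 2, 4`, `v₃(j) ≥ 8 ∧ v₃(j) ≢ 0 ∧ K ≡ ±1 (mod 9)` — there
no prime of `ℚ(θ)` over `3` has `9 ∣ ef` (kit j135556), so no `Stab`-invariant of a CYCLIC
`9`-group can work.  Nothing booked; no label change.

References: [Maier2006] Table 4 (N = 3, 9), §5; [SerreAbelianLadic1968] IV-23;
[SerreLocalFields1979] Ch. I §7; [Kato2004Asterisque] (12.5.2).
-/

noncomputable section

set_option maxRecDepth 10000

open scoped Classical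

open WeierstrassCurve Field

namespace Summit.BirchSwinnertonDyer.Rank1Residual.GaloisImage

open Literature.NumberTheory.EllipticCurves Literature.NumberTheory.GaloisRepresentations
  Rat.HeightOneSpectrum

variable (W : WeierstrassCurve ℚ) [W.IsElliptic]

/-- **THE TOWER AT `v₃(j) = 3k + 4 ≥ 10`, `j/3^{v₃(j)} ∈ {2, 4, 5, 7} (mod 9)`.**  For `E/ℚ` with
`ρ̄_{E,3}` onto, `k ≥ 2`, `ε, e₁ = ±1` and `9 ∣ num(j/3^{3k+4} − (ε − 3e₁))`, `ρ̄_{E,3ⁿ}` is onto for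
every `n` (the `Stab(ℤQ)`-invariant `z = (3^{2k+2}θ/(2(θ³ − 24)(e₁(θ³ − 24) + 3^{k+1})))² − 1 ∈
ℚ(E[9])`, `θ = η(E, ℤQ) + 3`, has `3`-adic valuation exactly `4/9`; scalar-stabiliser criterion).
[cite: SerreAbelianLadic1968, Ch. IV §3.4, Lemma 3 (IV-23)] [cite: Maier2006, Table 4 (N = 9) and §5] -/
theorem towerSurj_three_of_surj_of_nine_dvd_num_vone (hsurj : W.HasSurjectiveModNGaloisRep 3)
    {k : ℕ} (hk : 2 ≤ k) {ε e₁ : ℤ} (hε : ε = 1 ∨ ε = -1) (he : e₁ = 1 ∨ e₁ = -1)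
    (hj0 : (9 : ℤ) ∣ (W.j / 3 ^ (3 * k + 4) - ((ε - 3 * e₁ : ℤ) : ℚ)).num) (n : ℕ) :
    W.HasSurjectiveModNGaloisRep (3 ^ n : ℕ) := by
  haveI : Fact (Nat.Prime 3) := ⟨Nat.prime_three⟩
  set v := (placeOver 3).valuation with hv
  set t := v (3 : AlgebraicClosure ℚ) with ht
  have ht0 : t ≠ 0 := valuation_three_ne_zero
  have hc3 : ¬ (3 : ℤ) ∣ (ε - 3 * e₁) := by
    rcases hε with h | h <;> rcases he with h' | h' <;> rw [h, h'] <;> decide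
  have hjV := (padicValRat_eq_of_nine_dvd_num_sub (V := 3 * k + 4) hc3 hj0).1
  obtain ⟨Q, θ, hQ₉, hθL, hθfix, hjθ, hvS⟩ :=
    exists_nineTorsion_hauptmodulNine_of_four_le W (by rw [hjV]; push_cast; omega)
  -- the curve-free core: `v(z)⁹ = t⁴`
  have hz := valuation_hauptmodul_nine_invariant_vone_pow_nine hk hε he hj0 hjθ hvS rfl
  set z := (3 ^ (2 * k + 2) * θ / (2 * (θ ^ 3 - 24) * (e₁ * (θ ^ 3 - 24) + 3 ^ (k + 1)))) ^ 2 - 1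
    with hzdef
  have hz0 : z ≠ 0 := by
    intro h0
    rw [h0, map_zero, zero_pow (by norm_num)] at hz
    exact pow_ne_zero 4 ht0 hz.symm
  have hzL : z ∈ W.divisionField 9 :=
    sub_mem (pow_mem (div_mem (mul_mem (pow_mem (ofNat_mem _ 3) _) hθL) (mul_mem (mul_mem (ofNat_mem _ 2)
      (sub_mem (pow_mem hθL 3) (ofNat_mem _ 24))) (add_mem (mul_mem (intCast_mem _ e₁)
      (sub_mem (pow_mem hθL 3) (ofNat_mem _ 24))) (pow_mem (ofNat_mem _ 3) _)))) 2) (one_mem _)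
  have hfix : ∀ σ : absoluteGaloisGroup ℚ, (∃ c : ℤ, σ • Q = c • Q) → σ • z = z := by
    intro σ hσ
    have hθ' : absoluteGaloisGroup.toAlgEquiv ℚ σ θ = θ := by
      rw [← absoluteGaloisGroup.smul_def]; exact hθfix σ hσ
    rw [absoluteGaloisGroup.smul_def, hzdef]
    simp only [map_sub, map_div₀, map_mul, map_pow, map_add, map_ofNat, map_one, map_intCast, hθ']
  -- the scalar-stabiliser tower criterion with `d = 9`, `a = 0`, `b = 4`
  have hval : v z ^ 9 * t ^ 0 = t ^ 4 := by rw [pow_zero, mul_one]; exact hz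
  have hcop : IsCoprime ((9 : ℕ) : ℤ) (((0 : ℕ) : ℤ) - ((4 : ℕ) : ℤ)) := ⟨1, 2, by norm_num⟩
  exact towerSurj_three_of_surj_of_valuation_of_smul_zmultiples W hsurj hQ₉ hzL hz0 hfix hval hcop
    (dvd_refl 9) n

/-- **Kato's (12.5.2) at `p = 3` on the family `v₃(j) = 3k + 4 ≥ 10`, `j/3^{v₃(j)} ∈ {2, 4, 5, 7}
(mod 9)`** from surj(3).
[cite: Kato2004Asterisque, (12.5.2) (p. 222)] [cite: SerreAbelianLadic1968, Ch. IV §3.4, Lemma 3 (IV-23)] -/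
theorem imageContainsSL2_three_of_surj_of_nine_dvd_num_vone
    (hsurj : W.HasSurjectiveModNGaloisRep 3) {k : ℕ} (hk : 2 ≤ k) {ε e₁ : ℤ}
    (hε : ε = 1 ∨ ε = -1) (he : e₁ = 1 ∨ e₁ = -1)
    (hj0 : (9 : ℤ) ∣ (W.j / 3 ^ (3 * k + 4) - ((ε - 3 * e₁ : ℤ) : ℚ)).num) :
    Kato2004.ImageContainsSL2 W 3 := by
  haveI : Fact (Nat.Prime 3) := ⟨Nat.prime_three⟩
  exact (Kato2004.imageContainsSL2_iff_forall_hasSurjectiveModNGaloisRep W 3).mpr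
    (towerSurj_three_of_surj_of_nine_dvd_num_vone W hsurj hk hε he hj0)

/-- **THE TOWER AT `v₃(j) = 3k + 5 ≥ 8`, `j/3^{v₃(j)} ∈ {2, 4, 5, 7} (mod 9)`.**  For `E/ℚ` with
`ρ̄_{E,3}` onto, `k ≥ 1`, `ε, e₁ = ±1` and `9 ∣ num(j/3^{3k+5} − (ε − 3e₁))`, `ρ̄_{E,3ⁿ}` is onto for
every `n` (the `Stab(ℤQ)`-invariant `z = (θ(θ³ − 24)²/(2·3^{k+2}(θ³ − 24 − 3^{k+2}e₁)))² − 1 ∈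
ℚ(E[9])` has `3`-adic valuation exactly `4/9`; scalar-stabiliser criterion).
[cite: SerreAbelianLadic1968, Ch. IV §3.4, Lemma 3 (IV-23)] [cite: Maier2006, Table 4 (N = 9) and §5] -/
theorem towerSurj_three_of_surj_of_nine_dvd_num_vtwo (hsurj : W.HasSurjectiveModNGaloisRep 3)
    {k : ℕ} (hk : 1 ≤ k) {ε e₁ : ℤ} (hε : ε = 1 ∨ ε = -1) (he : e₁ = 1 ∨ e₁ = -1)
    (hj0 : (9 : ℤ) ∣ (W.j / 3 ^ (3 * k + 5) - ((ε - 3 * e₁ : ℤ) : ℚ)).num) (n : ℕ) :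
    W.HasSurjectiveModNGaloisRep (3 ^ n : ℕ) := by
  haveI : Fact (Nat.Prime 3) := ⟨Nat.prime_three⟩
  set v := (placeOver 3).valuation with hv
  set t := v (3 : AlgebraicClosure ℚ) with ht
  have ht0 : t ≠ 0 := valuation_three_ne_zero
  have hc3 : ¬ (3 : ℤ) ∣ (ε - 3 * e₁) := by
    rcases hε with h | h <;> rcases he with h' | h' <;> rw [h, h'] <;> decide
  have hjV := (padicValRat_eq_of_nine_dvd_num_sub (V := 3 * k + 5) hc3 hj0).1
  obtain ⟨Q, θ, hQ₉, hθL, hθfix, hjθ, hvS⟩ :=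
    exists_nineTorsion_hauptmodulNine_of_four_le W (by rw [hjV]; push_cast; omega)
  -- the curve-free core: `v(z)⁹ = t⁴`
  have hz := valuation_hauptmodul_nine_invariant_vtwo_pow_nine hk hε he hj0 hjθ hvS rfl
  set z := (θ * (θ ^ 3 - 24) ^ 2 / (2 * 3 ^ (k + 2) * (θ ^ 3 - 24 - 3 ^ (k + 2) * e₁))) ^ 2 - 1
    with hzdef
  have hz0 : z ≠ 0 := by
    intro h0
    rw [h0, map_zero, zero_pow (by norm_num)] at hz
    exact pow_ne_zero 4 ht0 hz.symm
  have hzL : z ∈ W.divisionField 9 :=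
    sub_mem (pow_mem (div_mem (mul_mem hθL (pow_mem (sub_mem (pow_mem hθL 3) (ofNat_mem _ 24)) 2))
      (mul_mem (mul_mem (ofNat_mem _ 2) (pow_mem (ofNat_mem _ 3) _)) (sub_mem (sub_mem (pow_mem hθL 3)
      (ofNat_mem _ 24)) (mul_mem (pow_mem (ofNat_mem _ 3) _) (intCast_mem _ e₁))))) 2) (one_mem _)
  have hfix : ∀ σ : absoluteGaloisGroup ℚ, (∃ c : ℤ, σ • Q = c • Q) → σ • z = z := by
    intro σ hσ
    have hθ' : absoluteGaloisGroup.toAlgEquiv ℚ σ θ = θ := by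
      rw [← absoluteGaloisGroup.smul_def]; exact hθfix σ hσ
    rw [absoluteGaloisGroup.smul_def, hzdef]
    simp only [map_sub, map_div₀, map_mul, map_pow, map_ofNat, map_one, map_intCast, hθ']
  -- the scalar-stabiliser tower criterion with `d = 9`, `a = 0`, `b = 4`
  have hval : v z ^ 9 * t ^ 0 = t ^ 4 := by rw [pow_zero, mul_one]; exact hz
  have hcop : IsCoprime ((9 : ℕ) : ℤ) (((0 : ℕ) : ℤ) - ((4 : ℕ) : ℤ)) := ⟨1, 2, by norm_num⟩
  exact towerSurj_three_of_surj_of_valuation_of_smul_zmultiples W hsurj hQ₉ hzL hz0 hfix hval hcop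
    (dvd_refl 9) n

/-- **Kato's (12.5.2) at `p = 3` on the family `v₃(j) = 3k + 5 ≥ 8`, `j/3^{v₃(j)} ∈ {2, 4, 5, 7}
(mod 9)`** from surj(3).
[cite: Kato2004Asterisque, (12.5.2) (p. 222)] [cite: SerreAbelianLadic1968, Ch. IV §3.4, Lemma 3 (IV-23)] -/
theorem imageContainsSL2_three_of_surj_of_nine_dvd_num_vtwo
    (hsurj : W.HasSurjectiveModNGaloisRep 3) {k : ℕ} (hk : 1 ≤ k) {ε e₁ : ℤ}
    (hε : ε = 1 ∨ ε = -1) (he : e₁ = 1 ∨ e₁ = -1)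
    (hj0 : (9 : ℤ) ∣ (W.j / 3 ^ (3 * k + 5) - ((ε - 3 * e₁ : ℤ) : ℚ)).num) :
    Kato2004.ImageContainsSL2 W 3 := by
  haveI : Fact (Nat.Prime 3) := ⟨Nat.prime_three⟩
  exact (Kato2004.imageContainsSL2_iff_forall_hasSurjectiveModNGaloisRep W 3).mpr
    (towerSurj_three_of_surj_of_nine_dvd_num_vtwo W hsurj hk hε he hj0)

end Summit.BirchSwinnertonDyer.Rank1Residual.GaloisImage
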